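import Literature.AlgebraicGeometry.Resolution.FiniteExtensionUniformizationProofs
import Literature.AlgebraicGeometry.Resolution.ValuedFunctionFieldsLemmas
import Literature.AlgebraicGeometry.Resolution.SeparablyDefectlessDenseDescent
import Literature.AlgebraicGeometry.Resolution.KnafKuhlmann2009Thm11Parts
import Literature.AlgebraicGeometry.Resolution.CompositeValuations
import HarnessLib

/-!
# Finite generation of the residue field of an Abhyankar coarsening (`stub_residue_gen`, unfolded form)

Stub of the birth line of the crux `ShadowsUniformize` (route `AbhyankarShadows`, item
stmt-ResolutionOfSingularities-16756), composite-discrete branch (Novacoski–Spivakovsky composition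
of a uniformizable coarsening `O₁ ⊇ O` with a discrete residue valuation on `κ(O₁)`): the
composition needs the residue field `κ(O₁) = O₁ / 𝔪_{O₁}` to be generated over (the image of) the
ground field `k` by the residues of finitely many elements of the FINER ring `O`.

Setting: `K/k` a finitely generated field extension, `k` algebraically closed, `O ≤ O₁` valuation
subrings of `K` containing `k`, and `O₁` either an Abhyankar place of `K/k`
(`IsAbhyankarPlace O₁ k ⊤`) or in the dense-Abhyankar locus (an Abhyankar place of a finitely
generated subextension `K₀/k` with `K` dense over `K₀`, `IsDenseIn O₁ K₀ ⊤`).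

Claim: there is a finite `S ⊆ O` such that every subfield of `κ(O₁)` containing the residues of `k`
and of `S` is all of `κ(O₁)`.

Proof. (1) `κ(O₁)` is finitely generated over the residue field `kP` of `k`: in the Abhyankar case
this is Knaf–Kuhlmann 2005, Cor. 2.2 (`KnafKuhlmann2005_Cor22_holds`, applied inside `Ω := K` with
`V := O₁`, `F := ⊤`; `resField O₁ ⊤ = κ(O₁)` as the residue map is onto); in the dense case Cor. 2.2
for `F := K₀` gives finite generation of `K₀P` over `kP`, and `K₀P = KP = κ(O₁)` because a dense
extension is immediate (`IsDenseIn.isImmediateOver`). (2) Each of the finitely many generators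
`r ∈ κ(O₁)` is the residue of an element of `O` or the inverse of such a residue: the image of `O`
in `κ(O₁)` is a valuation ring of `κ(O₁)` (`residueValuationSubring`, Novacoski–Spivakovsky 2014,
§2.1), so `r` or `r⁻¹` lies in it. Collecting these elements of `O` gives `S`; a subfield containing
the residues of `k` (`= kP`) and of `S` contains every generator, hence is `⊤`.
-/

noncomputable section

-- single-problem summit: the doubled namespace component is forced
set_option linter.dupNamespace false

open Literature.AlgebraicGeometry.Resolution IsLocalRing

namespace Summit.ResolutionOfSingularities.ResolutionOfSingularities.Theorems

/-- For a coarsening `O ≤ O₁` of valuation rings of `K`, every residue class of `O₁` is the residue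
of an element of `O` or the inverse of such a residue: the image of `O` in `κ(O₁)` is a valuation
ring of `κ(O₁)` (`residueValuationSubring`). [folklore] -/
theorem exists_residue_inclusion_eq_or_eq_inv {K : Type*} [Field K] (O O₁ : ValuationSubring K)
    (hO : O ≤ O₁) (r : ResidueField O₁) :
    ∃ a : O, residue O₁ ⟨(a : K), hO a.2⟩ = r ∨ residue O₁ ⟨(a : K), hO a.2⟩ = r⁻¹ := by
  rcases (residueValuationSubring O O₁ hO).mem_or_inv_mem r with h | h
  · obtain ⟨a, ha⟩ := (mem_residueValuationSubring_iff O O₁ hO r).mp h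
    exact ⟨a, Or.inl ha⟩
  · obtain ⟨a, ha⟩ := (mem_residueValuationSubring_iff O O₁ hO r⁻¹).mp h
    exact ⟨a, Or.inr ha⟩

/-- The residue field of the whole field is the whole residue field: the residue map of `O₁` is
onto. [folklore] -/
theorem resField_top_eq_top {K : Type*} [Field K] (O₁ : ValuationSubring K) :
    resField O₁ (⊤ : Subfield K) = ⊤ := by
  refine eq_top_iff.mpr fun r _ => ?_
  obtain ⟨a, rfl⟩ := residue_surjective r
  exact residue_mem_resField O₁ a (Subfield.mem_top _)

/-- For an intermediate field generated by `s`, the underlying subfield is the subfield generated by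
the image of the ground field and `s` (definitional). [folklore] -/
theorem toSubfield_adjoin_eq_closure {k K : Type*} [Field k] [Field K] [Algebra k K] (s : Set K) :
    (IntermediateField.adjoin k s).toSubfield =
      Subfield.closure (((algebraMap k K).fieldRange : Set K) ∪ s) := by
  rw [RingHom.coe_fieldRange]
  rfl

/-- **Finite generation of the residue field of an Abhyankar / dense-Abhyankar coarsening by
residues from the finer ring.** If `O₁ ⊇ O ∋ k` is an Abhyankar place of the function field `K/k`
(Knaf–Kuhlmann 2005, Cor. 2.2: `κ(O₁) | k` is finitely generated) or lies in the dense-Abhyankar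
locus (the same for `K₀`, and `κ(O₁ ∩ K₀) = κ(O₁)` by immediacy of dense extensions), then `κ(O₁)`
is generated over `k` by the residues of finitely many elements of `O`: a generator which is the
residue of `y ∈ O₁ ∖ O` is replaced by its inverse, the residue of `y⁻¹ ∈ O`. The second disjunct
of `hA₁` is the crux's `IsDenseAbhyankar O₁`, unfolded (whence the name; the skeleton's
`stub_residue_gen` is this theorem verbatim). [cite: KnafKuhlmann2005, Cor. 2.2] -/
theorem stub_residue_gen_unfolded (k K : Type) [Field k] [IsAlgClosed k] [Field K] [Algebra k K]
    (hfg : (⊤ : IntermediateField k K).FG) (O O₁ : ValuationSubring K) (hO : O ≤ O₁)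
    (hk : ∀ c : k, algebraMap k K c ∈ O)
    (hA₁ : IsAbhyankarPlace O₁ (algebraMap k K).fieldRange ⊤ ∨
      ∃ K₀ : IntermediateField k K, K₀.FG ∧
        IsAbhyankarPlace O₁ (algebraMap k K).fieldRange K₀.toSubfield ∧
          IsDenseIn O₁ K₀.toSubfield ⊤) :
    ∃ S : Finset O, ∀ T : Subfield (IsLocalRing.ResidueField O₁),
      (∀ c : k, IsLocalRing.residue O₁ ⟨algebraMap k K c, hO (hk c)⟩ ∈ T) →
      (∀ s ∈ S, IsLocalRing.residue O₁ ⟨(s : K), hO s.2⟩ ∈ T) → T = ⊤ := by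
  classical
  -- (1) `κ(O₁)` is finitely generated over the residue field of `k` (KK05 Cor. 2.2, + immediacy).
  have hgen : ∃ t : Finset (ResidueField O₁),
      Subfield.closure ((resField O₁ (algebraMap k K).fieldRange : Set (ResidueField O₁)) ∪ t) =
        ⊤ := by
    rcases hA₁ with hA | ⟨K₀, hK₀fg, hA, hd⟩
    · have hfg₀ : FGOver (algebraMap k K).fieldRange (⊤ : Subfield K) := by
        obtain ⟨s, hs⟩ := hfg
        refine ⟨s, ?_⟩
        rw [← toSubfield_adjoin_eq_closure, hs]
        rfl
      obtain ⟨-, t, ht⟩ :=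
        KnafKuhlmann2005_Cor22_holds K O₁ (algebraMap k K).fieldRange ⊤ le_top hfg₀ hA
      exact ⟨t, ht.trans (resField_top_eq_top O₁)⟩
    · have hle : (algebraMap k K).fieldRange ≤ K₀.toSubfield := by
        rintro x ⟨c, rfl⟩
        exact K₀.algebraMap_mem c
      have hfgK₀ : FGOver (algebraMap k K).fieldRange K₀.toSubfield := by
        obtain ⟨s, hs⟩ := hK₀fg
        refine ⟨s, ?_⟩
        rw [← toSubfield_adjoin_eq_closure, hs]
      obtain ⟨-, t, ht⟩ :=
        KnafKuhlmann2005_Cor22_holds K O₁ (algebraMap k K).fieldRange K₀.toSubfield hle hfgK₀ hA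
      refine ⟨t, ht.trans (eq_top_iff.mpr ?_)⟩
      rw [← resField_top_eq_top O₁]
      exact hd.isImmediateOver.2
  -- (2) lift the generators to `O` (up to inversion) and conclude.
  obtain ⟨t, ht⟩ := hgen
  choose f hf using exists_residue_inclusion_eq_or_eq_inv O O₁ hO
  refine ⟨t.image f, fun T hTk hTS => eq_top_iff.mpr ?_⟩
  rw [← ht, Subfield.closure_le]
  rintro r (hr | hr)
  · obtain ⟨a, ha, rfl⟩ := (mem_resField_iff O₁ _ r).mp hr
    obtain ⟨c, hc⟩ := RingHom.mem_fieldRange.mp ha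
    have hac : a = ⟨algebraMap k K c, hO (hk c)⟩ := Subtype.ext hc.symm
    rw [hac]
    exact hTk c
  · have hmem : residue O₁ ⟨(f r : K), hO (f r).2⟩ ∈ T := hTS (f r) (Finset.mem_image_of_mem f hr)
    rcases hf r with h | h
    · rw [h] at hmem
      exact hmem
    · have hinv := T.inv_mem hmem
      rw [h, inv_inv] at hinv
      exact hinv

end Summit.ResolutionOfSingularities.ResolutionOfSingularities.Theorems

end
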